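import Summits.BirchSwinnertonDyer.BirchSwinnertonDyer.Theorems.ErratumRoadFiveRest3DWitnessD1VisibleKernel
import Summits.BirchSwinnertonDyer.BirchSwinnertonDyer.Theorems.ErratumRoadFiveRest3DWitnessD2RankKernel
import Summits.BirchSwinnertonDyer.Rank1Residual.GaloisImage.LocalThreeTorsionAdicCompletionAt
import Summits.BirchSwinnertonDyer.Rank1Residual.Additive.AdicIntegersQuotientPrimePowCard
import Literature.NumberTheory.EllipticCurves.LutzNagellGeneralWeierstrass
import HarnessLib

/-!
# Route `SemiOrdinaryEisensteinDescent`, crux #2″ `WildSplitEisensteinValueAtOneV` (E_𝟙^V, stmt-BirchSwinnertonDyer-26610):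
# the VISIBILITY PARTNER of the content row `371682b1` — `F = 13766a1 = [1, 0, 1, −23, 42]` has Mordell–Weil rank `≥ 3`, IN THE KERNEL
# (cell `pub/bsd-wall`, width seat `bsd-wall-soed-p1-w3` g20; `--supports stmt-BirchSwinnertonDyer-26610`; THEOREMS ONLY; Theses-FREE)

WHY. Modulo print and the rank-zero leaf Z, crux #2″ is «`Typed.MissingLowerBoundAt W 3` on the cell» (w3 g14); in Cremona's range its
content is nine curves with `#Ш_an = 9`, each `3`-congruent to a RANK-3 curve at lower `3`-level (memo
`Cruxes/WildSplitEisensteinInclusionAtThree/E1V-VISIBLE-NINE-w3g20.md`). The visibility door for analytic rank one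
(`VisibleLowerHalf.missingLowerBoundAt_of_congr_of_places_of_analyticRank_one`) must PAY the place above `3` (the cell curve is additive
there), so the count `3^{rank E}·#F(ℚ₃)[3]·#(ℤ₃/3) < 3^{rank F}` needs a partner of rank THREE. This file certifies `3 ≤ rank F(ℚ)` for the
partner `F = 13766a1` (`N′ = 2·6883`, `Δ′ = −2⁴·6883`, Cremona generators `P₁ = (3,0)`, `P₂ = (−1,8)`, `P₃ = (2,1)`) by the tree's kernel
`3`-descent (`Rank2.linearIndependent_triple_of_three_descent`, pattern of `ErratumRoadFiveRest3DWitnessD2RankKernel.lean`): reductions at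
the good primes `7` (`#F̃ = 12`, nine representatives of `ℙ²(𝔽₃)`, multiplier `4`), `11` (`#F̃ = 15`, three, multiplier `5`), `17`
(`#F̃ = 24`, one, multiplier `8`), no rational `3`-torsion by `13` (`#F̃ = 20`); all point identities decided by `decide +kernel` on Mathlib's
group law over `ZMod ℓ`. The companion file `…Visible371682b1.lean` consumes `three_le_rank_F` and `isElliptic_F`.

HONEST FRAMING: THEOREMS ONLY (no definition, no named fact, no `sorry`); statements about ONE explicit curve; closes nothing; BSD is not
proved by any of this.

References: [SilvermanAEC2009] III.1, VII.2.1, VII.3.1(b), VIII.6.7; Cassels, *Lectures on Elliptic Curves* §13 [folklore];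
[CremonaMazur2000] §3; [Cremona1997] Table 1 (13766a1: generators from Cremona's `ecdata/allgens`).
-/

-- the Theorems namespace of this sub repeats the summit name by design (D-0017 nested layout)
set_option linter.dupNamespace false
set_option autoImplicit false

noncomputable section

open scoped Classical

open WeierstrassCurve IsDedekindDomain NumberField Rat.HeightOneSpectrum
  Literature.NumberTheory.EllipticCurves Literature.NumberTheory.EllipticCurves.Rank1Residual
  Literature.NumberTheory.EllipticCurves.Rank1Residual.Typed
  Literature.NumberTheory.EllipticCurves.Rank1Residual.X11RankOneCertificates
  Summit.BirchSwinnertonDyer.BirchSwinnertonDyer.Rank1Residual.IntModel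
  Summit.BirchSwinnertonDyer.Rank1Residual Summit.BirchSwinnertonDyer.Rank1Residual.X11b
  Summit.BirchSwinnertonDyer.Rank1Residual.Supersingular
  Summit.BirchSwinnertonDyer.Rank1Residual.GaloisImage
  Summit.BirchSwinnertonDyer.Rank2

namespace Summit.BirchSwinnertonDyer.BirchSwinnertonDyer.Theorems

namespace Visible371682b1

open VisiblePlaces D1VisibleKernel

/-! ## §1 The partner `F = 13766a1 = [1, 0, 1, −23, 42]`: model, three points, `3 ≤ rank F(ℚ)` by a `3`-descent in the kernel -/

/-- `Δ(F) = −110128 = −2⁴·6883`. [cite: Cremona1997, Table 1 (curve 13766a1)] -/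
theorem F_Δ : (⟨1, 0, 1, -23, 42⟩ : WeierstrassCurve ℤ).Δ = -110128 := by decide

/-- `c₄(F) = 1081` (odd, prime to `6883`). [folklore] -/
theorem F_c₄ : (⟨1, 0, 1, -23, 42⟩ : WeierstrassCurve ℤ).c₄ = 1081 := by decide

/-- The rational model of `F` is the base change of the integer one. [folklore] -/
theorem F_map_eq : (⟨1, 0, 1, -23, 42⟩ : WeierstrassCurve ℤ).map (Int.castRingHom ℚ) = (⟨1, 0, 1, -23, 42⟩ : WeierstrassCurve ℚ) := by
  ext <;> simp [WeierstrassCurve.map]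

/-- The same in `baseChange` form. [folklore] -/
theorem F_baseChange_eq : (⟨1, 0, 1, -23, 42⟩ : WeierstrassCurve ℤ).baseChange ℚ = (⟨1, 0, 1, -23, 42⟩ : WeierstrassCurve ℚ) :=
  F_map_eq

/-- `Δ(F/ℚ) ≠ 0`. [folklore] -/
theorem F_map_Δ_ne_zero : ((⟨1, 0, 1, -23, 42⟩ : WeierstrassCurve ℤ).map (Int.castRingHom ℚ)).Δ ≠ 0 := by
  rw [WeierstrassCurve.map_Δ, F_Δ]; norm_num

/-- `F/ℚ` is an elliptic curve. [cite: Cremona1997, Table 1 (curve 13766a1)] -/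
theorem isElliptic_F : (⟨1, 0, 1, -23, 42⟩ : WeierstrassCurve ℚ).IsElliptic :=
  isElliptic_of_discOf_ne_zero 1 0 1 (-23) 42 (by decide +kernel)

/-- `P₁ = (3, 0)` lies on `F`. [cite: Cremona1997, Table 1 (curve 13766a1)] -/
theorem nonsingular_P₁ : ((⟨1, 0, 1, -23, 42⟩ : WeierstrassCurve ℤ).map (Int.castRingHom ℚ)).toAffine.Nonsingular ((3 : ℤ) : ℚ) ((0 : ℤ) : ℚ) :=
  (Affine.equation_iff_nonsingular_of_Δ_ne_zero F_map_Δ_ne_zero).mp (by rw [F_map_eq, Affine.equation_iff]; norm_num)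

/-- `P₂ = (−1, 8)` lies on `F`. [cite: Cremona1997, Table 1 (curve 13766a1)] -/
theorem nonsingular_P₂ : ((⟨1, 0, 1, -23, 42⟩ : WeierstrassCurve ℤ).map (Int.castRingHom ℚ)).toAffine.Nonsingular ((-1 : ℤ) : ℚ) ((8 : ℤ) : ℚ) :=
  (Affine.equation_iff_nonsingular_of_Δ_ne_zero F_map_Δ_ne_zero).mp (by rw [F_map_eq, Affine.equation_iff]; norm_num)

/-- `P₃ = (2, 1)` lies on `F`. [cite: Cremona1997, Table 1 (curve 13766a1)] -/
theorem nonsingular_P₃ : ((⟨1, 0, 1, -23, 42⟩ : WeierstrassCurve ℤ).map (Int.castRingHom ℚ)).toAffine.Nonsingular ((2 : ℤ) : ℚ) ((1 : ℤ) : ℚ) :=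
  (Affine.equation_iff_nonsingular_of_Δ_ne_zero F_map_Δ_ne_zero).mp (by rw [F_map_eq, Affine.equation_iff]; norm_num)

/-- `7, 11, 13, 17` are good primes of `F`. [folklore] -/
theorem F_good_primes :
    ¬ ((7 : ℤ) ∣ (⟨1, 0, 1, -23, 42⟩ : WeierstrassCurve ℤ).Δ) ∧ ¬ ((11 : ℤ) ∣ (⟨1, 0, 1, -23, 42⟩ : WeierstrassCurve ℤ).Δ) ∧
    ¬ ((13 : ℤ) ∣ (⟨1, 0, 1, -23, 42⟩ : WeierstrassCurve ℤ).Δ) ∧ ¬ ((17 : ℤ) ∣ (⟨1, 0, 1, -23, 42⟩ : WeierstrassCurve ℤ).Δ) := by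
  rw [F_Δ]; norm_num

/-- The reduction of `F` at a good prime `ℓ` with the images of `P₁, P₂, P₃` (tree `intModel_exists_reductionHom`).
[cite: SilvermanAEC2009, Prop. VII.2.1] -/
theorem F_exists_red (ℓ : ℕ) [Fact ℓ.Prime] (hΔ : ¬ ((ℓ : ℤ) ∣ (⟨1, 0, 1, -23, 42⟩ : WeierstrassCurve ℤ).Δ)) :
    ∃ red : ((⟨1, 0, 1, -23, 42⟩ : WeierstrassCurve ℤ).map (Int.castRingHom ℚ)).toAffine.Point →+
        ((⟨1, 0, 1, -23, 42⟩ : WeierstrassCurve ℤ).map (Int.castRingHom (ZMod ℓ))).toAffine.Point,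
      (∀ (n : ℤ), ¬ ((ℓ : ℤ) ∣ n) → ∀ P : ((⟨1, 0, 1, -23, 42⟩ : WeierstrassCurve ℤ).map (Int.castRingHom ℚ)).toAffine.Point,
          n • P = 0 → red P = 0 → P = 0) ∧
      red (.some _ _ nonsingular_P₁) = .some _ _ (intModel_nonsingular_reduce _ ℓ hΔ 3 0 nonsingular_P₁) ∧
      red (.some _ _ nonsingular_P₂) = .some _ _ (intModel_nonsingular_reduce _ ℓ hΔ (-1) 8 nonsingular_P₂) ∧
      red (.some _ _ nonsingular_P₃) = .some _ _ (intModel_nonsingular_reduce _ ℓ hΔ 2 1 nonsingular_P₃) := by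
  obtain ⟨red, hsome, hinj⟩ := intModel_exists_reductionHom (⟨1, 0, 1, -23, 42⟩ : WeierstrassCurve ℤ) ℓ hΔ
  exact ⟨red, hinj, hsome 3 0 _ _, hsome (-1) 8 _ _, hsome 2 1 _ _⟩

/-- `#F̃(𝔽₇) = 12` (kernel-decided). [folklore] -/
theorem card_F_7 : Nat.card (((⟨1, 0, 1, -23, 42⟩ : WeierstrassCurve ℤ).map (Int.castRingHom (ZMod 7))).toAffine.Point) = 12 := by
  rw [@WeierstrassCurve.natCard_point_eq_one_add_card (ZMod 7) (@ZMod.instField 7 ⟨by norm_num⟩) _ _ _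
    (by decide +kernel), @card_sol_eq_sum_euler (ZMod 7) (@ZMod.instField 7 ⟨by norm_num⟩) _ _
    (by rw [ZMod.ringChar_zmod_n]; decide), ZMod.card]
  decide +kernel

/-- `#F̃(𝔽₁₁) = 15` (kernel-decided). [folklore] -/
theorem card_F_11 : Nat.card (((⟨1, 0, 1, -23, 42⟩ : WeierstrassCurve ℤ).map (Int.castRingHom (ZMod 11))).toAffine.Point) = 15 := by
  rw [@WeierstrassCurve.natCard_point_eq_one_add_card (ZMod 11) (@ZMod.instField 11 ⟨by norm_num⟩) _ _ _
    (by decide +kernel), @card_sol_eq_sum_euler (ZMod 11) (@ZMod.instField 11 ⟨by norm_num⟩) _ _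
    (by rw [ZMod.ringChar_zmod_n]; decide), ZMod.card]
  decide +kernel

/-- `#F̃(𝔽₁₃) = 20` (kernel-decided; prime to `3`). [folklore] -/
theorem card_F_13 : Nat.card (((⟨1, 0, 1, -23, 42⟩ : WeierstrassCurve ℤ).map (Int.castRingHom (ZMod 13))).toAffine.Point) = 20 := by
  rw [@WeierstrassCurve.natCard_point_eq_one_add_card (ZMod 13) (@ZMod.instField 13 ⟨by norm_num⟩) _ _ _
    (by decide +kernel), @card_sol_eq_sum_euler (ZMod 13) (@ZMod.instField 13 ⟨by norm_num⟩) _ _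
    (by rw [ZMod.ringChar_zmod_n]; decide), ZMod.card]
  decide +kernel

/-- `#F̃(𝔽₁₇) = 24` (kernel-decided). [folklore] -/
theorem card_F_17 : Nat.card (((⟨1, 0, 1, -23, 42⟩ : WeierstrassCurve ℤ).map (Int.castRingHom (ZMod 17))).toAffine.Point) = 24 := by
  rw [@WeierstrassCurve.natCard_point_eq_one_add_card (ZMod 17) (@ZMod.instField 17 ⟨by norm_num⟩) _ _ _
    (by decide +kernel), @card_sol_eq_sum_euler (ZMod 17) (@ZMod.instField 17 ⟨by norm_num⟩) _ _
    (by rw [ZMod.ringChar_zmod_n]; decide), ZMod.card]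
  decide +kernel

/-- **The `𝔽₇` certificates** (`#F̃(𝔽₇) = 12`, test multiplier `4`): `4·ū ≠ Õ` for the representatives
`P₁`, `P₂`, `P₃`, `P₁ + P₂`, `P₁ + P₃`, `P₂ + P₃`, `P₁ + P₂ + 2 • P₃`, `P₁ + 2 • P₂ + P₃`, `P₁ + 2 • P₂ + 2 • P₃`
(Mathlib's group law over `ZMod 7`, kernel-decided). [folklore] -/
theorem cert_F_7 [Fact (Nat.Prime 7)] :
    let P₁ : ((⟨1, 0, 1, -23, 42⟩ : WeierstrassCurve ℤ).map (Int.castRingHom (ZMod 7))).toAffine.Point :=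
      .some _ _ (intModel_nonsingular_reduce _ 7 F_good_primes.1 3 0 nonsingular_P₁)
    let P₂ : ((⟨1, 0, 1, -23, 42⟩ : WeierstrassCurve ℤ).map (Int.castRingHom (ZMod 7))).toAffine.Point :=
      .some _ _ (intModel_nonsingular_reduce _ 7 F_good_primes.1 (-1) 8 nonsingular_P₂)
    let P₃ : ((⟨1, 0, 1, -23, 42⟩ : WeierstrassCurve ℤ).map (Int.castRingHom (ZMod 7))).toAffine.Point :=
      .some _ _ (intModel_nonsingular_reduce _ 7 F_good_primes.1 2 1 nonsingular_P₃)
    (4 : ℕ) • P₁ ≠ 0 ∧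
    (4 : ℕ) • P₂ ≠ 0 ∧
    (4 : ℕ) • P₃ ≠ 0 ∧
    (4 : ℕ) • (P₁ + P₂) ≠ 0 ∧
    (4 : ℕ) • (P₁ + P₃) ≠ 0 ∧
    (4 : ℕ) • (P₂ + P₃) ≠ 0 ∧
    (4 : ℕ) • (P₁ + P₂ + 2 • P₃) ≠ 0 ∧
    (4 : ℕ) • (P₁ + 2 • P₂ + P₃) ≠ 0 ∧
    (4 : ℕ) • (P₁ + 2 • P₂ + 2 • P₃) ≠ 0 := by
  intro P₁ P₂ P₃
  refine ⟨?_, ?_, ?_, ?_, ?_, ?_, ?_, ?_, ?_⟩ <;> decide +kernel +revert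

/-- **The `𝔽₁₁` certificates** (`#F̃(𝔽₁₁) = 15`, test multiplier `5`): `5·ū ≠ Õ` for `P₁ + 2 • P₂`, `P₁ + 2 • P₃`, `P₂ + 2 • P₃`
(kernel-decided). [folklore] -/
theorem cert_F_11 [Fact (Nat.Prime 11)] :
    let P₁ : ((⟨1, 0, 1, -23, 42⟩ : WeierstrassCurve ℤ).map (Int.castRingHom (ZMod 11))).toAffine.Point :=
      .some _ _ (intModel_nonsingular_reduce _ 11 F_good_primes.2.1 3 0 nonsingular_P₁)
    let P₂ : ((⟨1, 0, 1, -23, 42⟩ : WeierstrassCurve ℤ).map (Int.castRingHom (ZMod 11))).toAffine.Point :=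
      .some _ _ (intModel_nonsingular_reduce _ 11 F_good_primes.2.1 (-1) 8 nonsingular_P₂)
    let P₃ : ((⟨1, 0, 1, -23, 42⟩ : WeierstrassCurve ℤ).map (Int.castRingHom (ZMod 11))).toAffine.Point :=
      .some _ _ (intModel_nonsingular_reduce _ 11 F_good_primes.2.1 2 1 nonsingular_P₃)
    (5 : ℕ) • (P₁ + 2 • P₂) ≠ 0 ∧
    (5 : ℕ) • (P₁ + 2 • P₃) ≠ 0 ∧
    (5 : ℕ) • (P₂ + 2 • P₃) ≠ 0 := by
  intro P₁ P₂ P₃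
  refine ⟨?_, ?_, ?_⟩ <;> decide +kernel +revert

/-- **The `𝔽₁₇` certificate** (`#F̃(𝔽₁₇) = 24`, test multiplier `8`): `8·(P̄₁ + P̄₂ + P̄₃) ≠ Õ` (kernel-decided). [folklore] -/
theorem cert_F_17 [Fact (Nat.Prime 17)] :
    let P₁ : ((⟨1, 0, 1, -23, 42⟩ : WeierstrassCurve ℤ).map (Int.castRingHom (ZMod 17))).toAffine.Point :=
      .some _ _ (intModel_nonsingular_reduce _ 17 F_good_primes.2.2.2 3 0 nonsingular_P₁)
    let P₂ : ((⟨1, 0, 1, -23, 42⟩ : WeierstrassCurve ℤ).map (Int.castRingHom (ZMod 17))).toAffine.Point :=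
      .some _ _ (intModel_nonsingular_reduce _ 17 F_good_primes.2.2.2 (-1) 8 nonsingular_P₂)
    let P₃ : ((⟨1, 0, 1, -23, 42⟩ : WeierstrassCurve ℤ).map (Int.castRingHom (ZMod 17))).toAffine.Point :=
      .some _ _ (intModel_nonsingular_reduce _ 17 F_good_primes.2.2.2 2 1 nonsingular_P₃)
    (8 : ℕ) • (P₁ + P₂ + P₃) ≠ 0 := by
  intro P₁ P₂ P₃
  decide +kernel +revert

/-- **`F(ℚ)` has no `3`-torsion**: reduction at the good prime `13` is injective on prime-to-`13` torsion and `#F̃(𝔽₁₃) = 20` is prime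
to `3`. [cite: SilvermanAEC2009, Prop. VII.3.1(b)] -/
theorem F_no_three_torsion (x : ((⟨1, 0, 1, -23, 42⟩ : WeierstrassCurve ℤ).map (Int.castRingHom ℚ)).toAffine.Point)
    (hx : (3 : ℤ) • x = 0) : x = 0 := by
  haveI : Fact (Nat.Prime 13) := ⟨by norm_num⟩
  obtain ⟨red, hinj, -, -, -⟩ := F_exists_red 13 F_good_primes.2.2.1
  refine hinj 3 (by decide) x hx ?_
  have hx' : (3 : ℕ) • x = 0 := by rw [ofNat_zsmul] at hx; exact hx
  have h3 : addOrderOf (red x) ∣ 3 := by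
    rw [addOrderOf_dvd_iff_nsmul_eq_zero, ← map_nsmul, hx', map_zero]
  have h20 : addOrderOf (red x) ∣ 20 := card_F_13 ▸ addOrderOf_dvd_natCard (red x)
  have h1 : addOrderOf (red x) ∣ Nat.gcd 3 20 := Nat.dvd_gcd h3 h20
  norm_num at h1
  exact h1

/-- **`P₁, P₂, P₃` are `ℤ`-linearly independent in `F(ℚ)`**: the `3`-descent certificate `Rank2.linearIndependent_triple_of_three_descent`
on the reductions at `7` (nine representatives, multiplier `4`), `11` (three, multiplier `5`) and `17` (one, multiplier `8`); no `3`-torsion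
by `13`. [cite: SilvermanAEC2009, Prop. VII.2.1 and Thm. VIII.6.7] -/
theorem F_linearIndependent :
    LinearIndependent ℤ
      ![(Affine.Point.some _ _ nonsingular_P₁ : ((⟨1, 0, 1, -23, 42⟩ : WeierstrassCurve ℤ).map (Int.castRingHom ℚ)).toAffine.Point),
        Affine.Point.some _ _ nonsingular_P₂, Affine.Point.some _ _ nonsingular_P₃] := by
  haveI : Fact (Nat.Prime 7) := ⟨by norm_num⟩
  haveI : Fact (Nat.Prime 11) := ⟨by norm_num⟩
  haveI : Fact (Nat.Prime 17) := ⟨by norm_num⟩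
  obtain ⟨r7, -, h7a, h7b, h7c⟩ := F_exists_red 7 F_good_primes.1
  obtain ⟨r11, -, h11a, h11b, h11c⟩ := F_exists_red 11 F_good_primes.2.1
  obtain ⟨r17, -, h17a, h17b, h17c⟩ := F_exists_red 17 F_good_primes.2.2.2
  obtain ⟨c100, c010, c001, c110, c101, c011, c112, c121, c122⟩ := cert_F_7
  obtain ⟨c120, c102, c012⟩ := cert_F_11
  have c111 := cert_F_17
  have d7 : 3 ∣ Nat.card (((⟨1, 0, 1, -23, 42⟩ : WeierstrassCurve ℤ).map (Int.castRingHom (ZMod 7))).toAffine.Point) := by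
    rw [card_F_7]; norm_num
  have d11 : 3 ∣ Nat.card (((⟨1, 0, 1, -23, 42⟩ : WeierstrassCurve ℤ).map (Int.castRingHom (ZMod 11))).toAffine.Point) := by
    rw [card_F_11]; norm_num
  have d17 : 3 ∣ Nat.card (((⟨1, 0, 1, -23, 42⟩ : WeierstrassCurve ℤ).map (Int.castRingHom (ZMod 17))).toAffine.Point) := by
    rw [card_F_17]; norm_num
  refine linearIndependent_triple_of_three_descent F_no_three_torsion _ _ _
    ?_ ?_ ?_ ?_ ?_ ?_ ?_ ?_ ?_ ?_ ?_ ?_ ?_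
  · exact not_three_dvd_of_cert r7 d7 (by rw [card_F_7, h7a]; exact c100)
  · exact not_three_dvd_of_cert r7 d7 (by rw [card_F_7, h7b]; exact c010)
  · exact not_three_dvd_of_cert r7 d7 (by rw [card_F_7, h7c]; exact c001)
  · exact not_three_dvd_of_cert r7 d7 (by rw [card_F_7, map_add, h7a, h7b]; exact c110)
  · exact not_three_dvd_of_cert r11 d11 (by rw [card_F_11, map_add, map_nsmul, h11a, h11b]; exact c120)
  · exact not_three_dvd_of_cert r7 d7 (by rw [card_F_7, map_add, h7a, h7c]; exact c101)
  · exact not_three_dvd_of_cert r11 d11 (by rw [card_F_11, map_add, map_nsmul, h11a, h11c]; exact c102)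
  · exact not_three_dvd_of_cert r7 d7 (by rw [card_F_7, map_add, h7b, h7c]; exact c011)
  · exact not_three_dvd_of_cert r11 d11 (by rw [card_F_11, map_add, map_nsmul, h11b, h11c]; exact c012)
  · exact not_three_dvd_of_cert r17 d17 (by rw [card_F_17, map_add, map_add, h17a, h17b, h17c]; exact c111)
  · exact not_three_dvd_of_cert r7 d7 (by rw [card_F_7, map_add, map_add, map_nsmul, h7a, h7b, h7c]; exact c112)
  · exact not_three_dvd_of_cert r7 d7 (by rw [card_F_7, map_add, map_add, map_nsmul, h7a, h7b, h7c]; exact c121)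
  · exact not_three_dvd_of_cert r7 d7 (by rw [card_F_7, map_add, map_add, map_nsmul, map_nsmul, h7a, h7b, h7c]; exact c122)

/-- **`3 ≤ rank F(ℚ)`** (Mordell–Weil + three independent points). [cite: SilvermanAEC2009, Thm. VIII.6.7] -/
theorem three_le_rank_F : 3 ≤ (⟨1, 0, 1, -23, 42⟩ : WeierstrassCurve ℚ).mordellWeilRank := by
  rw [← F_map_eq]
  haveI : ((⟨1, 0, 1, -23, 42⟩ : WeierstrassCurve ℤ).map (Int.castRingHom ℚ)).IsElliptic := ⟨isUnit_iff_ne_zero.mpr F_map_Δ_ne_zero⟩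
  refine three_le_mordellWeilRank_of_linearIndependent _ (module_finite_point_holds _)
    (P := .some _ _ nonsingular_P₁) (Q := .some _ _ nonsingular_P₂) (R := .some _ _ nonsingular_P₃) ?_
  convert F_linearIndependent

end Visible371682b1

end Summit.BirchSwinnertonDyer.BirchSwinnertonDyer.Theorems

end
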